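/-
Copyright: cell pub-balaban (hub tree, Literature side). Authors: seat b2b-balaban-b12-g20 (planner-b2b-balaban-b12-g20-0).
v1.1 (docstring-only DOCFIX, seat b2b-balaban-b12-g21): XREAD C-pv22g21-1 items D-1 (full «{b₀(c) : c ∈ T⁽ᵏ⁺¹⁾}» quotation)
and D-2 ("main term − corrections" is this lineage's phrase, no longer in guillemets); every declaration byte-identical to v1.
-/
import Mathlib
import Literature.MathematicalPhysics.QuantumFieldTheory.Balaban1983to89.B12HOperator267

/-!
# `Balaban1983to89.B12HOperatorNeumann267` — B12 [Balaban1987RG1] p. 267: the operator `h` for a PERTURBED corridor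
# coefficient `K(c) − S(c)` (the named unprinted smallness behind «Of course h is uniquely defined», cell GAPS
# C-adv7-109 (b), TYPED as a binder): existence, uniqueness, the Neumann-series formula and the norm bound.

## CITATION HEADER

* [B12] = [Balaban1987RG1] T. Bałaban, *Renormalization group approach to lattice gauge field theories. I*,
  Commun. Math. Phys. **109** (1987) 249–301; p. 267 [PDF 19] (render
  `b2b-balaban-ref1/pages/1987-cmp109-rg-I-small-field/1987-cmp109-rg-I-small-field-p019-x2.png`, read as an image by
  this seat).
* [B11] = T. Bałaban, *The variational problem and background fields in renormalization group method for lattice gauge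
  theories*, Commun. Math. Phys. **102** (1985) 277–309; p. 285 [PDF 9] (render
  `…/1985-cmp102-variational-background/1985-cmp102-variational-background-p009-x2.png`, read as an image by this seat).
* [B7] = [Balaban1985Avg] T. Bałaban, *Averaging operations for lattice gauge theories*, Commun. Math. Phys. **98**
  (1985) 17–51 — used only through the tree modules `B7Eq61Linearization` ((56) adjoint action, (61) main term `Q₀`)
  and `B12HOperator267` (its corridor coefficient `coef`, inverse `hMain`, norm `≤ Lᵈ/L`); no new quotation here.

## WHAT IS PRINTED (verbatim, «…»)

* [B12] p. 267: *«The function hB is equal to 0 everywhere, except the set {b₀(c) : c ∈ T⁽ᵏ⁺¹⁾}. […] Furthermore,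
  the operator h satisfies the identity LQ̃h = I on T⁽ᵏ⁺¹⁾. Of course h is uniquely defined by these conditions, in
  fact it is a very simple operator given by the equality (hB)(b₀(c)) = h(c)B(c), where h(c) is a linear operator on
  the Lie algebra 𝐠, equal to an inverse of a coefficient at the variable B′(b₀(c)) in (Q̃B′)(c), multiplied by
  L⁻¹.»*  (The square brackets `[…]` mark our elision of print's own bracketed reminder of the definition of `b₀(c)`.)
* [B12] p. 267, just before: *«In this integral we make a change of variables linearizing the function Q̃(B′). This
  operation was discussed several times in the previous papers, e.g. see Sect. C [15], Sect. E [14]. Here we have a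
  particularly simple unit lattice situation.»*
* [B11] p. 285, the multi-step template referred to: (44) *«Q_j(ηA) = LʲηQ_jA + C_j(LʲηA)»*, (45) *«LʲηQ_jHB = B
  on Λ_j»*, (46) *«|HB| ≦ B₀(Lʲη)⁻¹|B|, |∇HB| ≦ B₀(Lʲη)⁻²|B| on Ω_j.»*

## THE TYPING (= cell DIVERGENCE D-b12g20.2; honest scope)

`B12HOperator267` computes the corridor coefficient — «a coefficient at the variable B′(b₀(c)) in (Q̃B′)(c)» — for
the MAIN TERM `LQ̃ = Q₀` of [B7] (61) and inverts it in closed form (`hMain`, `‖h(c)‖ ≤ Lᵈ/L`).  For [B12]'s own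
Euclidean-symmetrised averages (0.4)/(0.12) at a non-flat background the coefficient is that main term PLUS
background-dependent corrections (cell GAPS C-adv7-109 (a)–(b), C-b12g20-1 (c)–(d)), which print never displays;
print's «an inverse of a coefficient» presupposes its invertibility.  THIS MODULE TYPES THAT PRESUPPOSITION AS A
BINDER and derives everything print asserts from it:

* (H_h, typed) the corridor coefficient of an additive `B(c₋) ∪ B(c₊)`-local average `𝒬` (`IsQppLocal`, any — in
  particular (0.4)/(0.12) once modelled) is `K(c) − S(c)` with `K(c) : V ≃L[ℝ] V` a Banach-space automorphism (for
  the main term: `(L⁻ᵈ·L)•Ad(g(c))`, `‖K(c)⁻¹‖ ≤ L^{d−1}`) and `‖K(c)⁻¹ ∘ S(c)‖ < 1`;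
* (conclusions) `K(c) − S(c)` is a bijection with inverse `(Σₙ (K⁻¹S)ⁿ) ∘ K⁻¹` (Mathlib `Units.oneSub`); hence
  (by `B12HOperator267` §2) a corridor-supported right inverse of `𝒬` EXISTS, is UNIQUE, is the diagonal operator
  `hOp b₀ h` with `h(c) = (K(c) − S(c))⁻¹` («LQ̃h = I», «uniquely defined», «(hB)(b₀(c)) = h(c)B(c)»), and
  `‖h(c)v‖ ≤ ‖K(c)⁻¹‖/(1 − ‖K(c)⁻¹S(c)‖)·‖v‖` — the unit-lattice analogue of [B11] (46)'s `B₀`; with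
  `‖K(c)⁻¹‖ ≤ L^{d−1}` and `L^{d−1}‖S(c)‖ < 1` this reads `‖h(c)‖ ≤ L^{d−1}/(1 − L^{d−1}‖S(c)‖)` (so the deviation
  budget is measured against `L^{1−d}`, cell GAPS C-b12g20-1 (c));
* (sharpness) at `‖K⁻¹S‖ = 1` nothing survives: `S = K` gives the zero coefficient, which has no right inverse on a
  nontrivial fibre (`not_surjective_of_S_eq_K`).

NOT DONE HERE: the corrections `S(c)` of (0.4)/(0.12) themselves (loop holonomies, `Ad(hol) − 1`, `D log` at the
holonomy) are not derived — `S` is a free binder; so this module does not prove that [B12]'s coefficient IS small-ly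
perturbed, only what follows once it is.  `V` is an abstract real Banach space standing for `𝐠` (or `𝐠ᶜ`, or a
matrix algebra); nothing here uses a Lie structure.

## WHAT IS PROVED (kernel; tags: [folklore] = standard functional analysis / bookkeeping, [cite] = transcription of
the printed sentence under the typed hypothesis)

§1 perturbed automorphisms of a Banach space (`relPert`, `perturb_eq_mul`, `neumannUnit`, `perturbInv`,
`perturbInv_apply_eq_tsum`, the two-sided inverse identities, `bijective_perturb`, a-priori bound `norm_le_of_perturb`,
`norm_perturbInv_le`, `opNorm_perturbInv_le`, `perturbInv_zero`); §2 corridor coefficients of the form `K − S`: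
`bijective_bcoef`, `exists_rightInverse`, `rightInverse_unique'`, `hNeu` + `rightInverse_hNeu`, `eq_hOp_hNeu`,
`hOp_hNeu_apply_b0Z`, `norm_hNeu_le`; §3 budget bookkeeping `‖K⁻¹‖ ≤ M`, `M‖S‖ < 1`: `norm_relPert_le`,
`hH_of_budget`, `norm_perturbInv_le_of_budget`, `norm_hNeu_le_pow`; §3b the MAIN TERM as `K(c)` in the adjoint model
`V = A`, `G = ConjAct Aˣ` ([B7] (56) `R(X)Y = XYX⁻¹`, as in `B7Eq61Linearization` §4 / `B12HOperator267` §5):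
`norm_coef_le_of_bond`, `KMain` (`coef` ⇄ `hMain` as `A ≃L[ℝ] A`), `norm_KMain_symm_le` (`≤ Lᵈ/L`),
`norm_KMain_symm_le_pow` (`≤ L^{d−1}`), `h_paragraph_p267_mainTerm` ("main term − corrections" — our phrase, not
print's; budget `(Lᵈ/L)‖S(c)‖ < 1`); §4 transcription `h_paragraph_p267_perturbed`, sharpness `not_surjective_of_S_eq_K`, and a
non-vacuity example (every `d`, every `L ≥ 1`).

VALUE: a typed, kernel-checked form of the one unprinted hypothesis of the h-paragraph (cell GAPS C-adv7-109 (b) /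
G-adv9-22 (U2)) with its exact consequences; NOT a derivation of that hypothesis; NOT summit progress.
ABSOLUTE RULE: nothing internal is cited as fact; the hypothesis is an explicit binder; print is quoted by page.
-/

noncomputable section

namespace Literature.MathematicalPhysics.QuantumFieldTheory.Balaban1983to89.B12HOperatorNeumann267

open Literature.MathematicalPhysics.QuantumLattice (ZdEdge)
open B13CorridorSeparation (b0Z b0Z_injective b0Z_mem_qppBonds)
open B13PkLocalTerms (hOp hOp_apply_b₀)
open B12HOperator267 (IsQppLocal bcoef CorridorSupported corridorSupported_hOp)

/-! ## §1  Perturbed automorphisms `K − S` of a real Banach space, `‖K⁻¹S‖ < 1` -/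

section Neumann

variable {V : Type*} [NormedAddCommGroup V] [NormedSpace ℝ V]

/-- [folklore] the relative perturbation `K⁻¹ ∘ S` as an element of the Banach algebra `V →L[ℝ] V`. -/
def relPert (K : V ≃L[ℝ] V) (S : V →L[ℝ] V) : V →L[ℝ] V := (K.symm : V →L[ℝ] V).comp S

/-- [folklore] unfolding. -/
@[simp] theorem relPert_apply (K : V ≃L[ℝ] V) (S : V →L[ℝ] V) (v : V) : relPert K S v = K.symm (S v) := rfl

/-- [folklore] `K − S = K ∘ (1 − K⁻¹S)`. -/
theorem perturb_eq_mul (K : V ≃L[ℝ] V) (S : V →L[ℝ] V) :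
    (K : V →L[ℝ] V) - S = (K : V →L[ℝ] V) * (1 - relPert K S) := by
  ext v
  simp [relPert_apply, map_sub]

variable [CompleteSpace V]

/-- [folklore] NEUMANN: `1 − K⁻¹S` is a unit of `V →L[ℝ] V` when `‖K⁻¹S‖ < 1`, with inverse `Σₙ (K⁻¹S)ⁿ`
(Mathlib `Units.oneSub`). -/
def neumannUnit (K : V ≃L[ℝ] V) (S : V →L[ℝ] V) (hq : ‖relPert K S‖ < 1) : (V →L[ℝ] V)ˣ :=
  Units.oneSub (relPert K S) hq

/-- [folklore] unfolding. -/
@[simp] theorem neumannUnit_val (K : V ≃L[ℝ] V) (S : V →L[ℝ] V) (hq : ‖relPert K S‖ < 1) :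
    ((neumannUnit K S hq : (V →L[ℝ] V)ˣ) : V →L[ℝ] V) = 1 - relPert K S := by
  simp [neumannUnit]

/-- [folklore] THE INVERSE of `K − S`: `(1 − K⁻¹S)⁻¹ ∘ K⁻¹ = (Σₙ (K⁻¹S)ⁿ) ∘ K⁻¹`. -/
def perturbInv (K : V ≃L[ℝ] V) (S : V →L[ℝ] V) (hq : ‖relPert K S‖ < 1) : V →L[ℝ] V :=
  ((neumannUnit K S hq)⁻¹ : (V →L[ℝ] V)ˣ).val.comp (K.symm : V →L[ℝ] V)

/-- [folklore] the Neumann-series form of the inverse: `(K − S)⁻¹ = (Σₙ (K⁻¹S)ⁿ) ∘ K⁻¹`. -/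
theorem perturbInv_apply_eq_tsum (K : V ≃L[ℝ] V) (S : V →L[ℝ] V) (hq : ‖relPert K S‖ < 1) (w : V) :
    perturbInv K S hq w = (∑' n : ℕ, relPert K S ^ n) (K.symm w) := by
  simp [perturbInv, neumannUnit, Units.oneSub]

/-- [folklore] `(K − S) ∘ (K − S)⁻¹ = id`. -/
theorem perturb_perturbInv (K : V ≃L[ℝ] V) (S : V →L[ℝ] V) (hq : ‖relPert K S‖ < 1) (w : V) :
    ((K : V →L[ℝ] V) - S) (perturbInv K S hq w) = w := by
  have hu : (neumannUnit K S hq).val * ((neumannUnit K S hq)⁻¹).val = 1 := Units.mul_inv _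
  have hu' : (1 - relPert K S) (((neumannUnit K S hq)⁻¹).val (K.symm w)) = K.symm w := by
    have h := congrArg (fun T : V →L[ℝ] V => T (K.symm w)) hu
    rw [neumannUnit_val] at h
    exact h
  rw [perturb_eq_mul]
  change K ((1 - relPert K S) (((neumannUnit K S hq)⁻¹).val (K.symm w))) = w
  rw [hu', ContinuousLinearEquiv.apply_symm_apply]

/-- [folklore] `(K − S)⁻¹ ∘ (K − S) = id`. -/
theorem perturbInv_perturb (K : V ≃L[ℝ] V) (S : V →L[ℝ] V) (hq : ‖relPert K S‖ < 1) (v : V) :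
    perturbInv K S hq (((K : V →L[ℝ] V) - S) v) = v := by
  have hu : ((neumannUnit K S hq)⁻¹).val * (neumannUnit K S hq).val = 1 := Units.inv_mul _
  have hu' : ((neumannUnit K S hq)⁻¹).val ((1 - relPert K S) v) = v := by
    have h := congrArg (fun T : V →L[ℝ] V => T v) hu
    rw [neumannUnit_val] at h
    exact h
  have hK : K.symm (((K : V →L[ℝ] V) - S) v) = (1 - relPert K S) v := by
    simp [map_sub, relPert_apply]
  change ((neumannUnit K S hq)⁻¹).val (K.symm (((K : V →L[ℝ] V) - S) v)) = v
  rw [hK, hu']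

/-- [folklore] hence `K − S` is a bijection of `V`. -/
theorem bijective_perturb (K : V ≃L[ℝ] V) (S : V →L[ℝ] V) (hq : ‖relPert K S‖ < 1) :
    Function.Bijective ((K : V →L[ℝ] V) - S) :=
  ⟨fun v₁ v₂ h => by
      have h' := congrArg (perturbInv K S hq) h
      rwa [perturbInv_perturb, perturbInv_perturb] at h',
    fun w => ⟨perturbInv K S hq w, perturb_perturbInv K S hq w⟩⟩

omit [CompleteSpace V] in
/-- [folklore] A-PRIORI BOUND: `‖v‖ ≤ ‖K⁻¹‖/(1 − ‖K⁻¹S‖)·‖(K − S)v‖` — from `v = K⁻¹((K − S)v) + K⁻¹Sv`. -/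
theorem norm_le_of_perturb (K : V ≃L[ℝ] V) (S : V →L[ℝ] V) (hq : ‖relPert K S‖ < 1) (v : V) :
    ‖v‖ ≤ ‖(K.symm : V →L[ℝ] V)‖ / (1 - ‖relPert K S‖) * ‖(((K : V →L[ℝ] V) - S) v)‖ := by
  set q := ‖relPert K S‖ with hqdef
  have hq1 : 0 < 1 - q := by linarith
  have hv : v = K.symm (((K : V →L[ℝ] V) - S) v) + relPert K S v := by
    simp [map_sub, relPert_apply]
  have h1 : ‖v‖ ≤ ‖(K.symm : V →L[ℝ] V)‖ * ‖((K : V →L[ℝ] V) - S) v‖ + q * ‖v‖ := by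
    calc ‖v‖ = ‖K.symm (((K : V →L[ℝ] V) - S) v) + relPert K S v‖ := by rw [← hv]
      _ ≤ ‖K.symm (((K : V →L[ℝ] V) - S) v)‖ + ‖relPert K S v‖ := norm_add_le _ _
      _ ≤ ‖(K.symm : V →L[ℝ] V)‖ * ‖((K : V →L[ℝ] V) - S) v‖ + q * ‖v‖ :=
          add_le_add ((K.symm : V →L[ℝ] V).le_opNorm _) ((relPert K S).le_opNorm v)
  have h2 : (1 - q) * ‖v‖ ≤ ‖(K.symm : V →L[ℝ] V)‖ * ‖((K : V →L[ℝ] V) - S) v‖ := by linarith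
  rw [div_mul_eq_mul_div, le_div_iff₀ hq1, mul_comm]
  exact h2

/-- [folklore] NORM OF THE INVERSE: `‖(K − S)⁻¹ w‖ ≤ ‖K⁻¹‖/(1 − ‖K⁻¹S‖)·‖w‖`. -/
theorem norm_perturbInv_le (K : V ≃L[ℝ] V) (S : V →L[ℝ] V) (hq : ‖relPert K S‖ < 1) (w : V) :
    ‖perturbInv K S hq w‖ ≤ ‖(K.symm : V →L[ℝ] V)‖ / (1 - ‖relPert K S‖) * ‖w‖ := by
  have h := norm_le_of_perturb K S hq (perturbInv K S hq w)
  rwa [perturb_perturbInv] at h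

/-- [folklore] operator-norm form. -/
theorem opNorm_perturbInv_le (K : V ≃L[ℝ] V) (S : V →L[ℝ] V) (hq : ‖relPert K S‖ < 1) :
    ‖perturbInv K S hq‖ ≤ ‖(K.symm : V →L[ℝ] V)‖ / (1 - ‖relPert K S‖) := by
  refine ContinuousLinearMap.opNorm_le_bound _ ?_ (norm_perturbInv_le K S hq)
  have : ‖relPert K S‖ < 1 := hq
  exact div_nonneg (norm_nonneg _) (by linarith)

/-- [folklore] consistency with the unperturbed case: `S = 0` gives `(K − 0)⁻¹ = K⁻¹` (for the main term this is
`B12HOperator267.hMain`'s shape `L⁻¹·(Q̃-coefficient)⁻¹`). -/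
theorem perturbInv_zero (K : V ≃L[ℝ] V) (hq : ‖relPert K (0 : V →L[ℝ] V)‖ < 1) (w : V) :
    perturbInv K 0 hq w = K.symm w := by
  have h := perturbInv_perturb K 0 hq (K.symm w)
  simpa using h

end Neumann

/-! ## §2  Corridor coefficients of the form `K(c) − S(c)`: [B12] p. 267's `h` exists, is unique, is diagonal, with
the Neumann formula and norm bound (the unprinted hypothesis H_h as the binders `hK`, `hq`) -/

section Corridor

variable {d : ℕ} {V : Type*} [NormedAddCommGroup V] [NormedSpace ℝ V] [CompleteSpace V]
variable {L : ℕ} {𝒬 : (ZdEdge d → V) → ZdEdge d → V}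
variable {K : ZdEdge d → (V ≃L[ℝ] V)} {S : ZdEdge d → (V →L[ℝ] V)}

/-- [folklore] under H_h every corridor coefficient is a bijection of the fibre. -/
theorem bijective_bcoef (hK : ∀ c v, bcoef L 𝒬 c v = K c v - S c v) (hq : ∀ c, ‖relPert (K c) (S c)‖ < 1)
    (c : ZdEdge d) : Function.Bijective (bcoef L 𝒬 c) := by
  have hfun : bcoef L 𝒬 c = fun v => (((K c : V →L[ℝ] V)) - S c) v := by
    funext v; simpa using hK c v
  rw [hfun]
  exact bijective_perturb (K c) (S c) (hq c)

/-- [cite: Balaban1987RG1, p.267] **EXISTENCE** of `h` («the operator h satisfies the identity LQ̃h = I on T⁽ᵏ⁺¹⁾»,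
with «The function hB is equal to 0 everywhere, except the set {b₀(c) : c ∈ T⁽ᵏ⁺¹⁾}») for ANY additive
`B(c₋) ∪ B(c₊)`-local `𝒬` whose
corridor coefficients have the typed form `K(c) − S(c)`, `‖K(c)⁻¹S(c)‖ < 1`. -/
theorem exists_rightInverse (h𝒬 : IsQppLocal L 𝒬) (hL : 0 < L)
    (hK : ∀ c v, bcoef L 𝒬 c v = K c v - S c v) (hq : ∀ c, ‖relPert (K c) (S c)‖ < 1) :
    ∃ 𝒽 : (ZdEdge d → V) → ZdEdge d → V, CorridorSupported L 𝒽 ∧ ∀ B c, 𝒬 (𝒽 B) c = B c :=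
  (h𝒬.exists_rightInverse_iff hL).2 fun c => (bijective_bcoef hK hq c).2

/-- [cite: Balaban1987RG1, p.267] **UNIQUENESS** («Of course h is uniquely defined by these conditions»). -/
theorem rightInverse_unique' (h𝒬 : IsQppLocal L 𝒬) (hL : 0 < L)
    (hK : ∀ c v, bcoef L 𝒬 c v = K c v - S c v) (hq : ∀ c, ‖relPert (K c) (S c)‖ < 1)
    {𝒽₁ 𝒽₂ : (ZdEdge d → V) → ZdEdge d → V} (hs₁ : CorridorSupported L 𝒽₁) (hs₂ : CorridorSupported L 𝒽₂)
    (h₁ : ∀ B c, 𝒬 (𝒽₁ B) c = B c) (h₂ : ∀ B c, 𝒬 (𝒽₂ B) c = B c) : 𝒽₁ = 𝒽₂ :=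
  h𝒬.rightInverse_unique hL (fun c => (bijective_bcoef hK hq c).1) hs₁ hs₂ h₁ h₂

/-- [folklore] THE FIBRE OPERATOR `h(c) := (K(c) − S(c))⁻¹ = (Σₙ (K(c)⁻¹S(c))ⁿ) ∘ K(c)⁻¹` («h(c) is a linear operator
on the Lie algebra 𝐠, equal to an inverse of a coefficient …»). -/
def hNeu (K : ZdEdge d → (V ≃L[ℝ] V)) (S : ZdEdge d → (V →L[ℝ] V)) (hq : ∀ c, ‖relPert (K c) (S c)‖ < 1)
    (c : ZdEdge d) : V →L[ℝ] V :=
  perturbInv (K c) (S c) (hq c)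

/-- [cite: Balaban1987RG1, p.267] **«LQ̃h = I»** for the diagonal operator built from `hNeu`:
`𝒬 (hOp b₀ h B)(c) = B(c)` for every coarse field `B`. -/
theorem rightInverse_hNeu (h𝒬 : IsQppLocal L 𝒬) (hL : 0 < L)
    (hK : ∀ c v, bcoef L 𝒬 c v = K c v - S c v) (hq : ∀ c, ‖relPert (K c) (S c)‖ < 1)
    (B : ZdEdge d → V) (c : ZdEdge d) :
    𝒬 (hOp (b0Z L) (fun c v => hNeu K S hq c v) B) c = B c := by
  refine (h𝒬.hOp_rightInverse_iff hL _).2 (fun c v => ?_) B c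
  rw [hK]
  simpa [hNeu] using perturb_perturbInv (K c) (S c) (hq c) v

/-- [cite: Balaban1987RG1, p.267] **«in fact it is a very simple operator given by the equality
(hB)(b₀(c)) = h(c)B(c)»**: EVERY corridor-supported right inverse of `𝒬` is the diagonal operator with fibre maps
`hNeu` — existence, uniqueness and the formula in one statement. -/
theorem eq_hOp_hNeu (h𝒬 : IsQppLocal L 𝒬) (hL : 0 < L)
    (hK : ∀ c v, bcoef L 𝒬 c v = K c v - S c v) (hq : ∀ c, ‖relPert (K c) (S c)‖ < 1)
    {𝒽 : (ZdEdge d → V) → ZdEdge d → V} (hs : CorridorSupported L 𝒽) (hinv : ∀ B c, 𝒬 (𝒽 B) c = B c) :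
    𝒽 = hOp (b0Z L) (fun c v => hNeu K S hq c v) :=
  rightInverse_unique' h𝒬 hL hK hq hs (corridorSupported_hOp L _) hinv (rightInverse_hNeu h𝒬 hL hK hq)

/-- [folklore] the value at the distinguished bond: `(hB)(b₀(c)) = h(c)B(c)`. -/
theorem hOp_hNeu_apply_b0Z (hL : 0 < L) (hq : ∀ c, ‖relPert (K c) (S c)‖ < 1) (B : ZdEdge d → V)
    (c : ZdEdge d) : hOp (b0Z L) (fun c v => hNeu K S hq c v) B (b0Z L c) = hNeu K S hq c (B c) :=
  hOp_apply_b₀ (b0Z_injective hL) _ B c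

/-- [folklore] **NORM BOUND** (the unit-lattice analogue of [B11] (46) «|HB| ≦ B₀(Lʲη)⁻¹|B|»):
`‖h(c)v‖ ≤ ‖K(c)⁻¹‖/(1 − ‖K(c)⁻¹S(c)‖)·‖v‖`. -/
theorem norm_hNeu_le (hq : ∀ c, ‖relPert (K c) (S c)‖ < 1) (c : ZdEdge d) (v : V) :
    ‖hNeu K S hq c v‖ ≤ ‖((K c).symm : V →L[ℝ] V)‖ / (1 - ‖relPert (K c) (S c)‖) * ‖v‖ :=
  norm_perturbInv_le (K c) (S c) (hq c) v

end Corridor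

/-! ## §3  Scale bookkeeping: `‖K(c)⁻¹‖ ≤ L^{d−1}` (the main-term value of `B12HOperator267.norm_hMain_le_of_bond`)
turns H_h into the budget `L^{d−1}‖S(c)‖ < 1` and the bound into `L^{d−1}/(1 − L^{d−1}‖S(c)‖)` -/

section Budget

variable {V : Type*} [NormedAddCommGroup V] [NormedSpace ℝ V] [CompleteSpace V]

omit [CompleteSpace V] in
/-- [folklore] `‖K⁻¹S‖ ≤ ‖K⁻¹‖·‖S‖`. -/
theorem norm_relPert_le (K : V ≃L[ℝ] V) (S : V →L[ℝ] V) :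
    ‖relPert K S‖ ≤ ‖(K.symm : V →L[ℝ] V)‖ * ‖S‖ :=
  ContinuousLinearMap.opNorm_comp_le _ _

omit [CompleteSpace V] in
/-- [folklore] the BUDGET form of H_h: `‖K⁻¹‖ ≤ M` and `M·‖S‖ < 1` give `‖K⁻¹S‖ < 1`. -/
theorem hH_of_budget {K : V ≃L[ℝ] V} {S : V →L[ℝ] V} {M : ℝ} (hKM : ‖(K.symm : V →L[ℝ] V)‖ ≤ M)
    (hS : M * ‖S‖ < 1) : ‖relPert K S‖ < 1 :=
  lt_of_le_of_lt ((norm_relPert_le K S).trans (mul_le_mul_of_nonneg_right hKM (norm_nonneg _))) hS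

/-- [folklore] and then `‖(K − S)⁻¹ w‖ ≤ M/(1 − M‖S‖)·‖w‖`. -/
theorem norm_perturbInv_le_of_budget {K : V ≃L[ℝ] V} {S : V →L[ℝ] V} {M : ℝ}
    (hKM : ‖(K.symm : V →L[ℝ] V)‖ ≤ M) (hS : M * ‖S‖ < 1) (w : V) :
    ‖perturbInv K S (hH_of_budget hKM hS) w‖ ≤ M / (1 - M * ‖S‖) * ‖w‖ := by
  have hq := hH_of_budget hKM hS
  have h0 : 0 ≤ M := (norm_nonneg _).trans hKM
  have h1 : 0 < 1 - M * ‖S‖ := by linarith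
  have h2 : 0 < 1 - ‖relPert K S‖ := by linarith
  have hle : ‖relPert K S‖ ≤ M * ‖S‖ :=
    (norm_relPert_le K S).trans (mul_le_mul_of_nonneg_right hKM (norm_nonneg _))
  refine (norm_perturbInv_le K S hq w).trans (mul_le_mul_of_nonneg_right ?_ (norm_nonneg _))
  calc ‖(K.symm : V →L[ℝ] V)‖ / (1 - ‖relPert K S‖) ≤ M / (1 - ‖relPert K S‖) :=
        div_le_div_of_nonneg_right hKM h2.le
    _ ≤ M / (1 - M * ‖S‖) := div_le_div_of_nonneg_left h0 h1 (by linarith)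

variable {d : ℕ} {L : ℕ} {K : ZdEdge d → (V ≃L[ℝ] V)} {S : ZdEdge d → (V →L[ℝ] V)}

/-- [folklore] **`‖h(c)v‖ ≤ L^{d−1}/(1 − L^{d−1}‖S(c)‖)·‖v‖`** when `‖K(c)⁻¹‖ ≤ L^{d−1}` (the main-term value,
`B12HOperator267.norm_hMain_le_of_bond`: `Lᵈ/L = L^{d−1}`) and `L^{d−1}‖S(c)‖ < 1` — the deviation budget is
measured against `L^{1−d}` (cell GAPS C-b12g20-1 (c)). -/
theorem norm_hNeu_le_pow (hd : 1 ≤ d) (hKM : ∀ c, ‖((K c).symm : V →L[ℝ] V)‖ ≤ (L : ℝ) ^ (d - 1))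
    (hS : ∀ c, (L : ℝ) ^ (d - 1) * ‖S c‖ < 1) (c : ZdEdge d) (v : V) :
    ‖hNeu K S (fun c => hH_of_budget (hKM c) (hS c)) c v‖
      ≤ (L : ℝ) ^ (d - 1) / (1 - (L : ℝ) ^ (d - 1) * ‖S c‖) * ‖v‖ := by
  have _ := hd
  exact norm_perturbInv_le_of_budget (hKM c) (hS c) v

end Budget

/-! ## §3b  The main term as `K(c)`: in the adjoint model ([B7] (56), `V = A` a real Banach algebra, `G = ConjAct Aˣ`)
with straight axis contours and bondwise unitarity, `B12HOperator267.coef` IS a Banach automorphism `KMain(c)` with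
`KMain(c)⁻¹ = hMain(c)` and `‖KMain(c)⁻¹‖ ≤ Lᵈ/L = L^{d−1}` — so §2–§3 apply to "main term − corrections" (our phrase,
not a printed one) verbatim -/

section MainTerm

open B12HOperator267 (AxisStraight gcorner coef coefₗ coefₗ_apply coef_eq_of_axisStraight hMain hMainₗ hMainₗ_apply
  coef_hMain hMain_coef norm_hMain_le_of_bond norm_ofConjAct_pathProd_le_one norm_ofConjAct_pathProd_inv_le_one
  pow_div_self_eq)
open B7Eq61Linearization (norm_conjAct_smul_le)

variable {d : ℕ} {A : Type*} [NormedRing A] [NormedAlgebra ℝ A] [NormOneClass A]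
  {L : ℕ} {T : (Fin d → ℤ) → ConjAct Aˣ} {R : ZdEdge d → ConjAct Aˣ}

/-- [folklore] forward bound `‖K(c)X‖ ≤ (L⁻ᵈ·L)‖X‖` for the main-term coefficient under bondwise unitarity. -/
theorem norm_coef_le_of_bond (hT : AxisStraight L T R) (hR : ∀ b, ‖((ConjAct.ofConjAct (R b) : Aˣ) : A)‖ ≤ 1)
    (hR' : ∀ b, ‖(((ConjAct.ofConjAct (R b))⁻¹ : Aˣ) : A)‖ ≤ 1) (c : ZdEdge d) (X : A) :
    ‖coef L T R c X‖ ≤ (((L : ℝ) ^ d)⁻¹ * L) * ‖X‖ := by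
  rw [coef_eq_of_axisStraight hT, norm_smul, Real.norm_of_nonneg (by positivity)]
  refine mul_le_mul_of_nonneg_left ?_ (by positivity)
  exact norm_conjAct_smul_le _ X (norm_ofConjAct_pathProd_le_one _ (fun _ => hR _) _)
    (norm_ofConjAct_pathProd_inv_le_one _ (fun _ => hR' _) _)

/-- [folklore] **THE MAIN-TERM COEFFICIENT AS A BANACH AUTOMORPHISM `KMain(c) : A ≃L[ℝ] A`**, forward map
`B12HOperator267.coef` («a coefficient at the variable B′(b₀(c)) in (Q̃B′)(c)» for `LQ̃ = Q₀`), inverse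
`B12HOperator267.hMain`. -/
def KMain (hT : AxisStraight L T R) (hL : 0 < L) (hR : ∀ b, ‖((ConjAct.ofConjAct (R b) : Aˣ) : A)‖ ≤ 1)
    (hR' : ∀ b, ‖(((ConjAct.ofConjAct (R b))⁻¹ : Aˣ) : A)‖ ≤ 1) (c : ZdEdge d) : A ≃L[ℝ] A :=
  ContinuousLinearEquiv.equivOfInverse
    ((coefₗ L T R c).mkContinuous (((L : ℝ) ^ d)⁻¹ * L) (norm_coef_le_of_bond hT hR hR' c))
    ((hMainₗ L R c).mkContinuous ((L : ℝ) ^ d / L) (fun X => norm_hMain_le_of_bond L R c X hR hR'))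
    (hMain_coef hT hL c) (coef_hMain hT hL c)

/-- [folklore] the forward map is `B12HOperator267.coef`. -/
@[simp] theorem KMain_apply (hT : AxisStraight L T R) (hL : 0 < L)
    (hR : ∀ b, ‖((ConjAct.ofConjAct (R b) : Aˣ) : A)‖ ≤ 1) (hR' : ∀ b, ‖(((ConjAct.ofConjAct (R b))⁻¹ : Aˣ) : A)‖ ≤ 1)
    (c : ZdEdge d) (X : A) : KMain hT hL hR hR' c X = coef L T R c X := rfl

/-- [folklore] `KMain(c)⁻¹ = h(c)` of `B12HOperator267` (print's «an inverse of a coefficient … multiplied by L⁻¹»). -/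
@[simp] theorem KMain_symm_apply (hT : AxisStraight L T R) (hL : 0 < L)
    (hR : ∀ b, ‖((ConjAct.ofConjAct (R b) : Aˣ) : A)‖ ≤ 1) (hR' : ∀ b, ‖(((ConjAct.ofConjAct (R b))⁻¹ : Aˣ) : A)‖ ≤ 1)
    (c : ZdEdge d) (X : A) : (KMain hT hL hR hR' c).symm X = hMain L R c X := rfl

/-- [folklore] **`‖KMain(c)⁻¹‖ ≤ Lᵈ/L`** (= `L^{d−1}`, `B12HOperator267.pow_div_self_eq`; the `B₀′` of cell GAPS
G-adv9-22 (U2)). -/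
theorem norm_KMain_symm_le (hT : AxisStraight L T R) (hL : 0 < L)
    (hR : ∀ b, ‖((ConjAct.ofConjAct (R b) : Aˣ) : A)‖ ≤ 1) (hR' : ∀ b, ‖(((ConjAct.ofConjAct (R b))⁻¹ : Aˣ) : A)‖ ≤ 1)
    (c : ZdEdge d) : ‖((KMain hT hL hR hR' c).symm : A →L[ℝ] A)‖ ≤ (L : ℝ) ^ d / L :=
  ContinuousLinearMap.opNorm_le_bound _ (by positivity) fun X => by
    rw [ContinuousLinearEquiv.coe_coe, KMain_symm_apply]
    exact norm_hMain_le_of_bond L R c X hR hR'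

/-- [folklore] the same with exponent `d − 1`. -/
theorem norm_KMain_symm_le_pow (hT : AxisStraight L T R) (hL : 0 < L) (hd : 1 ≤ d)
    (hR : ∀ b, ‖((ConjAct.ofConjAct (R b) : Aˣ) : A)‖ ≤ 1) (hR' : ∀ b, ‖(((ConjAct.ofConjAct (R b))⁻¹ : Aˣ) : A)‖ ≤ 1)
    (c : ZdEdge d) : ‖((KMain hT hL hR hR' c).symm : A →L[ℝ] A)‖ ≤ (L : ℝ) ^ (d - 1) := by
  rw [← pow_div_self_eq hL hd]; exact norm_KMain_symm_le hT hL hR hR' c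

variable [CompleteSpace A]

/-- [cite: Balaban1987RG1, p.267] **"MAIN TERM − CORRECTIONS"** (our phrase for the typing, not print's): for ANY additive
`B(c₋) ∪ B(c₊)`-local average `𝒬`
on `A`-valued bond fields whose corridor coefficient is the [B7] (61) main-term coefficient MINUS a correction `S(c)`
with `(Lᵈ/L)·‖S(c)‖ < 1` (H_h in budget form), the p. 267 operator `h` exists, every corridor-supported right
inverse of `𝒬` is the diagonal operator with fibre maps `(KMain(c) − S(c))⁻¹`, and
`‖h(c)X‖ ≤ (Lᵈ/L)/(1 − (Lᵈ/L)‖S(c)‖)·‖X‖`.  At `S = 0` this is `B12HOperator267.h_paragraph_p267`. -/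
theorem h_paragraph_p267_mainTerm (hT : AxisStraight L T R) (hL : 0 < L)
    (hR : ∀ b, ‖((ConjAct.ofConjAct (R b) : Aˣ) : A)‖ ≤ 1) (hR' : ∀ b, ‖(((ConjAct.ofConjAct (R b))⁻¹ : Aˣ) : A)‖ ≤ 1)
    {𝒬 : (ZdEdge d → A) → ZdEdge d → A} (h𝒬 : IsQppLocal L 𝒬) {S : ZdEdge d → (A →L[ℝ] A)}
    (hK : ∀ c X, bcoef L 𝒬 c X = coef L T R c X - S c X) (hS : ∀ c, (L : ℝ) ^ d / L * ‖S c‖ < 1) :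
    let hq : ∀ c, ‖relPert (KMain hT hL hR hR' c) (S c)‖ < 1 :=
      fun c => hH_of_budget (norm_KMain_symm_le hT hL hR hR' c) (hS c)
    (∀ B c, 𝒬 (hOp (b0Z L) (fun c X => hNeu (KMain hT hL hR hR') S hq c X) B) c = B c) ∧
    (∀ 𝒽 : (ZdEdge d → A) → ZdEdge d → A, CorridorSupported L 𝒽 → (∀ B c, 𝒬 (𝒽 B) c = B c) →
        𝒽 = hOp (b0Z L) (fun c X => hNeu (KMain hT hL hR hR') S hq c X)) ∧
    (∀ c X, ‖hNeu (KMain hT hL hR hR') S hq c X‖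
        ≤ ((L : ℝ) ^ d / L) / (1 - (L : ℝ) ^ d / L * ‖S c‖) * ‖X‖) := by
  intro hq
  have hK' : ∀ c X, bcoef L 𝒬 c X = KMain hT hL hR hR' c X - S c X := fun c X => by rw [KMain_apply]; exact hK c X
  exact ⟨rightInverse_hNeu h𝒬 hL hK' hq, fun _ hs hinv => eq_hOp_hNeu h𝒬 hL hK' hq hs hinv,
    fun c X => norm_perturbInv_le_of_budget (norm_KMain_symm_le hT hL hR hR' c) (hS c) X⟩

end MainTerm

/-! ## §4  Transcription of the p. 267 paragraph under the typed hypothesis, sharpness, non-vacuity -/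

section Transcription

variable {d : ℕ} {V : Type*} [NormedAddCommGroup V] [NormedSpace ℝ V] [CompleteSpace V]
variable {L : ℕ} {𝒬 : (ZdEdge d → V) → ZdEdge d → V}
variable {K : ZdEdge d → (V ≃L[ℝ] V)} {S : ZdEdge d → (V →L[ℝ] V)}

/-- [cite: Balaban1987RG1, p.267] **THE h-PARAGRAPH UNDER H_h.**  For an additive `B(c₋) ∪ B(c₊)`-local average
`𝒬` whose corridor coefficients are `K(c) − S(c)` with `‖K(c)⁻¹S(c)‖ < 1`: (i) «LQ̃h = I» for the diagonal `h` with
fibre maps `h(c) = (K(c) − S(c))⁻¹`; (ii) «Of course h is uniquely defined by these conditions, in fact it is a very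
simple operator given by the equality (hB)(b₀(c)) = h(c)B(c)» — every corridor-supported right inverse is that
diagonal operator; (iii) «h(c) is a linear operator» (a continuous linear map) with
`‖h(c)v‖ ≤ ‖K(c)⁻¹‖/(1 − ‖K(c)⁻¹S(c)‖)·‖v‖`. -/
theorem h_paragraph_p267_perturbed (h𝒬 : IsQppLocal L 𝒬) (hL : 0 < L)
    (hK : ∀ c v, bcoef L 𝒬 c v = K c v - S c v) (hq : ∀ c, ‖relPert (K c) (S c)‖ < 1) :
    (∀ B c, 𝒬 (hOp (b0Z L) (fun c v => hNeu K S hq c v) B) c = B c) ∧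
    (∀ 𝒽 : (ZdEdge d → V) → ZdEdge d → V, CorridorSupported L 𝒽 → (∀ B c, 𝒬 (𝒽 B) c = B c) →
        𝒽 = hOp (b0Z L) (fun c v => hNeu K S hq c v)) ∧
    (∀ c v, ‖hNeu K S hq c v‖ ≤ ‖((K c).symm : V →L[ℝ] V)‖ / (1 - ‖relPert (K c) (S c)‖) * ‖v‖) :=
  ⟨rightInverse_hNeu h𝒬 hL hK hq, fun _ hs hinv => eq_hOp_hNeu h𝒬 hL hK hq hs hinv, norm_hNeu_le hq⟩

omit [CompleteSpace V] in
/-- [folklore] SHARPNESS of H_h at `‖K⁻¹S‖ = 1`: with `S = K` the relative perturbation is the identity (norm `1` on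
a nontrivial fibre) and the coefficient `K − S = 0` annihilates everything — no right inverse can exist for a
coefficient of this form (so «an inverse of a coefficient» genuinely presupposes smallness of the corrections). -/
theorem not_surjective_of_S_eq_K [Nontrivial V] (K : V ≃L[ℝ] V) :
    ‖relPert K (K : V →L[ℝ] V)‖ = 1 ∧ ¬ Function.Surjective ((K : V →L[ℝ] V) - (K : V →L[ℝ] V)) := by
  refine ⟨?_, ?_⟩
  · have : relPert K (K : V →L[ℝ] V) = 1 := by
      ext v; simp [relPert_apply]
    rw [this, norm_one]
  · intro hsurj
    obtain ⟨v, hv⟩ := exists_ne (0 : V)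
    obtain ⟨w, hw⟩ := hsurj v
    exact hv (by simpa using hw.symm)

/-- Non-vacuity [folklore]: the hypotheses of §2 are met, for every dimension `d` and ratio `L ≥ 1`, by the scalar
model `V = ℝ`, `𝒬 A c := 2·A(b₀(c)) − A(b₀(c))/2` (coefficient `K − S` with `K = 2`, `S = ½`, `‖K⁻¹S‖ = ¼ < 1`);
the resulting `h(c)` inverts `3/2`, and the paragraph theorem applies. -/
example {d L : ℕ} (hL : 0 < L) :
    ∃ (𝒬 : (ZdEdge d → ℝ) → ZdEdge d → ℝ) (K : ZdEdge d → (ℝ ≃L[ℝ] ℝ)) (S : ZdEdge d → (ℝ →L[ℝ] ℝ))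
    (hq : ∀ c, ‖relPert (K c) (S c)‖ < 1),
    IsQppLocal L 𝒬 ∧ (∀ c v, bcoef L 𝒬 c v = K c v - S c v) ∧
    (∀ B c, 𝒬 (hOp (b0Z L) (fun c v => hNeu K S hq c v) B) c = B c) ∧
    (∀ c v, hNeu K S hq c ((3 / 2 : ℝ) * v) = v) := by
  obtain ⟨K₀, hK₀, hK₀s⟩ : ∃ K₀ : ℝ ≃L[ℝ] ℝ, (∀ v, K₀ v = 2 * v) ∧ (∀ v, K₀.symm v = v / 2) := by
    refine ⟨ContinuousLinearEquiv.equivOfInverse ((2 : ℝ) • ContinuousLinearMap.id ℝ ℝ)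
      ((1 / 2 : ℝ) • ContinuousLinearMap.id ℝ ℝ) (fun v => ?_) (fun v => ?_), fun v => ?_, fun v => ?_⟩
    · simp
    · simp
    · simp
    · show ((1 / 2 : ℝ) • ContinuousLinearMap.id ℝ ℝ) v = v / 2
      simp [div_eq_inv_mul]
  set S₀ : ℝ →L[ℝ] ℝ := (1 / 2 : ℝ) • ContinuousLinearMap.id ℝ ℝ with hS₀def
  have hS₀ : ∀ v : ℝ, S₀ v = v / 2 := fun v => by simp [hS₀def, div_eq_inv_mul]
  have hrel : relPert K₀ S₀ = (1 / 4 : ℝ) • ContinuousLinearMap.id ℝ ℝ := by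
    ext
    simp [relPert_apply, hS₀, hK₀s]
    norm_num
  have hq : ∀ c : ZdEdge d, ‖relPert ((fun _ => K₀) c) ((fun _ => S₀) c)‖ < 1 := by
    intro c
    show ‖relPert K₀ S₀‖ < 1
    rw [hrel, norm_smul, ContinuousLinearMap.norm_id]; norm_num
  have hloc : IsQppLocal L (fun (A : ZdEdge d → ℝ) c => 2 * A (b0Z L c) - A (b0Z L c) / 2) := by
    intro A A' c hAA'
    simp only [hAA' _ (b0Z_mem_qppBonds hL c)]
  have hK : ∀ c v, bcoef L (fun (A : ZdEdge d → ℝ) c => 2 * A (b0Z L c) - A (b0Z L c) / 2) c v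
      = (fun _ => K₀) c v - (fun _ => S₀) c v := by
    intro c v
    simp [bcoef, hK₀, hS₀]
  refine ⟨_, fun _ => K₀, fun _ => S₀, hq, hloc, hK, rightInverse_hNeu hloc hL hK hq, fun c v => ?_⟩
  have h := perturbInv_perturb K₀ S₀ (hq c) v
  have hKS : ((K₀ : ℝ →L[ℝ] ℝ) - S₀) v = (3 / 2 : ℝ) * v := by
    simp [hK₀, hS₀]; ring
  rw [hKS] at h
  simpa [hNeu] using h

end Transcription

end Literature.MathematicalPhysics.QuantumFieldTheory.Balaban1983to89.B12HOperatorNeumann267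

end
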